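import Mathlib
import HarnessLib

/-!
# Route `KLProgramme` — K3 engine (stmt-HubbardSuperconductivity-20437), stub (b) (ℓ)/(I2)–(I3), located item «ABS-UMK-COUNT» / «UV-REMEASURE-COUNT»:
# lattice points in thin level sets, part 1 — grids are separated, CUBE PACKING, Lipschitz thickening of a level window, homothety helpers

Cell gate-hubbard-kl, seat p4 g14 (pen (R133)(ii): the decision-independent brick of «ABS-UMK-COUNT»; memos HOME/prover-p4/UV-REMEASURE-COUNT.md,
TIGHT-RELCOUNT-LAW.md §3(B)).  The sector-counting lemmas of the cell reduce, on the umklapp-active «corner bundles», to counting the points of a grid of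
spacing `h = w′` (the fine angular width) in a thin level window `{β − δ ≤ F ≤ β + δ}` (`δ ≍ w′`) of the NORMAL component `F` of the bundle's momentum sum — a
strongly convex function of the `d = L − 2` free angles near a corner direction.  This file and its sequel `…ThinLevelSetVolume` provide the generic
(model-free) steps, in `ι → ℝ` with the sup norm (balls are cubes):

* `dist_grid_ge` — two distinct points of a grid `x₀ + h·n`, `n ∈ ℤ^ι`, are at sup-distance `≥ h`;
* `card_mul_pow_le_volume_thickening` — CUBE PACKING: an `h`-separated finite subset of `S` has `card · h^d ≤ vol(thickening (h/2) S)`;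
* `thickening_levelWindow_subset` — the `r`-thickening of a level window of an `L`-Lipschitz function lies in the level window widened by `L·r`;
* `homothety_mem_of_convex`, `norm_homothety_sub`, `homothety_eq_add_smul`, `one_sub_mul_le_one_sub_pow` — helpers for the sequel's homothety argument.

Everything is PROVED; no definitions, no named facts; generic real analysis — nothing about the model or superconductivity is asserted. [folklore]
-/

noncomputable section

open Real Set MeasureTheory Metric
open scoped ENNReal

namespace Summit.HubbardSuperconductivity.HubbardSuperconductivity.Theorems.ThinLevelSet

set_option linter.dupNamespace false -- summit = problem name (single-conjunct summit), D-0017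

variable {ι : Type*} [Fintype ι]

/-! ## §1 Grids are separated; cube packing -/

/-- Two distinct points of the grid `x₀ + h·n` (`n ∈ ℤ^ι`) are at sup-distance at least `h`. [folklore] -/
theorem dist_grid_ge {h : ℝ} (hh : 0 < h) (x₀ : ι → ℝ) {n m : ι → ℤ} (hnm : n ≠ m) :
    h ≤ dist (fun i => x₀ i + h * n i) (fun i => x₀ i + h * m i) := by
  obtain ⟨i, hi⟩ := Function.ne_iff.1 hnm
  set f : ι → ℝ := fun i => x₀ i + h * n i with hf
  set g : ι → ℝ := fun i => x₀ i + h * m i with hg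
  have h1 : dist (f i) (g i) ≤ dist f g := dist_le_pi_dist f g i
  have h2 : h ≤ dist (f i) (g i) := by
    simp only [hf, hg]
    rw [Real.dist_eq, show x₀ i + h * n i - (x₀ i + h * m i) = h * ((n i : ℝ) - m i) by ring, abs_mul, abs_of_pos hh]
    have hz : (n i - m i : ℤ) ≠ 0 := sub_ne_zero.2 hi
    have h3 : (1 : ℝ) ≤ |((n i - m i : ℤ) : ℝ)| := by exact_mod_cast Int.one_le_abs hz
    push_cast at h3
    nlinarith
  exact h2.trans h1

/-- **Cube packing.** If the points of a finite set `P ⊆ S` are pairwise at sup-distance `≥ h`, then `#P · h^d ≤ vol(thickening (h/2) S)`: the open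
sup-norm balls of radius `h/2` about the points are disjoint cubes of volume `h^d` inside the thickening. [folklore] -/
theorem card_mul_pow_le_volume_thickening {h : ℝ} (hh : 0 < h) (P : Finset (ι → ℝ)) (S : Set (ι → ℝ))
    (hPS : ∀ p ∈ P, p ∈ S) (hsep : ∀ p ∈ P, ∀ q ∈ P, p ≠ q → h ≤ dist p q) :
    (P.card : ℝ≥0∞) * ENNReal.ofReal (h ^ Fintype.card ι) ≤ volume (Metric.thickening (h / 2) S) := by
  classical
  have hdisj : PairwiseDisjoint (↑P : Set (ι → ℝ)) (fun p => Metric.ball p (h / 2)) := by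
    intro p hp q hq hpq
    refine Set.disjoint_left.2 fun x hxp hxq => ?_
    have h1 : dist x p < h / 2 := mem_ball.1 hxp
    have h2 : dist x q < h / 2 := mem_ball.1 hxq
    have h3 := hsep p hp q hq hpq
    have h4 : dist p q ≤ dist p x + dist x q := dist_triangle p x q
    rw [dist_comm p x] at h4
    linarith
  have hmeas : ∀ p ∈ P, MeasurableSet (Metric.ball p (h / 2)) := fun p _ => measurableSet_ball
  have hsub : (⋃ p ∈ P, Metric.ball p (h / 2)) ⊆ Metric.thickening (h / 2) S := by
    intro x hx
    obtain ⟨p, hp, hxp⟩ := Set.mem_iUnion₂.1 hx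
    exact Metric.mem_thickening_iff.2 ⟨p, hPS p hp, mem_ball.1 hxp⟩
  have hvol : ∀ p ∈ P, volume (Metric.ball p (h / 2)) = ENNReal.ofReal (h ^ Fintype.card ι) := by
    intro p _
    rw [Real.volume_pi_ball p (by positivity : (0 : ℝ) < h / 2)]
    congr 2
    ring
  calc (P.card : ℝ≥0∞) * ENNReal.ofReal (h ^ Fintype.card ι)
      = ∑ p ∈ P, volume (Metric.ball p (h / 2)) := by
        rw [Finset.sum_congr rfl hvol, Finset.sum_const, nsmul_eq_mul]
    _ = volume (⋃ p ∈ P, Metric.ball p (h / 2)) := (measure_biUnion_finset hdisj hmeas).symm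
    _ ≤ volume (Metric.thickening (h / 2) S) := measure_mono hsub

/-! ## §2 Thickening a level window of a Lipschitz function -/

/-- The `r`-thickening of the level window `{x ∈ D : |F x − β| ≤ δ}` lies in the level window `{x ∈ D′ : |F x − β| ≤ δ + L·r}` as soon as `D′` contains
the `r`-thickening of `D` and `F` is `L`-Lipschitz on `D′`. [folklore] -/
theorem thickening_levelWindow_subset {X : Type*} [PseudoMetricSpace X] {D D' : Set X} {F : X → ℝ} {L r β δ : ℝ}
    (hD' : Metric.thickening r D ⊆ D') (hDD' : D ⊆ D') (hL0 : 0 ≤ L)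
    (hLip : ∀ x ∈ D', ∀ y ∈ D', |F x - F y| ≤ L * dist x y) :
    Metric.thickening r {x ∈ D | |F x - β| ≤ δ} ⊆ {x ∈ D' | |F x - β| ≤ δ + L * r} := by
  intro x hx
  obtain ⟨z, ⟨hzD, hzF⟩, hxz⟩ := Metric.mem_thickening_iff.1 hx
  have hxD' : x ∈ D' := hD' (Metric.mem_thickening_iff.2 ⟨z, hzD, hxz⟩)
  have hzD' : z ∈ D' := hDD' hzD
  refine ⟨hxD', ?_⟩
  have h1 := hLip x hxD' z hzD'
  calc |F x - β| ≤ |F x - F z| + |F z - β| := abs_sub_le _ _ _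
    _ ≤ L * dist x z + δ := add_le_add h1 hzF
    _ ≤ L * r + δ := by gcongr
    _ = δ + L * r := by ring

/-! ## §3 Helpers for the homothety argument of the sequel -/

/-- The point `x⋆ + t(x − x⋆)` of the segment `[x⋆, x]` of a convex set. [folklore] -/
theorem homothety_mem_of_convex {E : Type*} [AddCommGroup E] [Module ℝ E] {D : Set E} (hD : Convex ℝ D) {xs x : E} (hxs : xs ∈ D) (hx : x ∈ D)
    {t : ℝ} (ht0 : 0 ≤ t) (ht1 : t ≤ 1) : AffineMap.homothety xs t x ∈ D := by
  have h := hD hxs hx (by linarith : (0 : ℝ) ≤ 1 - t) ht0 (by ring)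
  have e : AffineMap.homothety xs t x = (1 - t) • xs + t • x := by
    rw [AffineMap.homothety_apply, vsub_eq_sub, vadd_eq_add, smul_sub, sub_smul, one_smul]
    abel
  rw [e]; exact h

/-- `‖homothety x⋆ t x − x⋆‖ = |t|·‖x − x⋆‖`. [folklore] -/
theorem norm_homothety_sub {E : Type*} [NormedAddCommGroup E] [NormedSpace ℝ E] (xs x : E) (t : ℝ) :
    ‖AffineMap.homothety xs t x - xs‖ = |t| * ‖x - xs‖ := by
  rw [AffineMap.homothety_apply, vsub_eq_sub, vadd_eq_add, add_sub_cancel_right, norm_smul, Real.norm_eq_abs]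

/-- `homothety x⋆ t x = x⋆ + t • (x − x⋆)`. [folklore] -/
theorem homothety_eq_add_smul {E : Type*} [AddCommGroup E] [Module ℝ E] (xs x : E) (t : ℝ) :
    AffineMap.homothety xs t x = xs + t • (x - xs) := by
  rw [AffineMap.homothety_apply, vsub_eq_sub, vadd_eq_add, add_comm]

/-- Bernoulli's inequality in the form `1 − dθ ≤ (1 − θ)^d` for `0 ≤ θ ≤ 1`. [folklore] -/
theorem one_sub_mul_le_one_sub_pow {θ : ℝ} (hθ1 : θ ≤ 1) (d : ℕ) : 1 - d * θ ≤ (1 - θ) ^ d := by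
  have h : 1 + (d : ℝ) * (-θ) ≤ (1 + (-θ)) ^ d := one_add_mul_le_pow (by linarith : (-2 : ℝ) ≤ -θ) d
  have e1 : (1 : ℝ) + -θ = 1 - θ := by ring
  have e2 : 1 + (d : ℝ) * (-θ) = 1 - d * θ := by ring
  rw [e1, e2] at h
  exact h

end Summit.HubbardSuperconductivity.HubbardSuperconductivity.Theorems.ThinLevelSet

end
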